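import Mathlib
import Literature.NumberTheory.LFunctions.Zhang2022.SkeletonPartThree
import Literature.NumberTheory.LFunctions.Zhang2022.TypedAppendixB
import Literature.NumberTheory.LFunctions.Zhang2022.AppendixBLemma151Prelims
import Literature.NumberTheory.LFunctions.GaussianHeckeContentMoment

/-!
# Zhang (2022) Appendix B ⇒ Lemma 15.1 (χ-twisted reading): the ASSEMBLY of Lemma 15.1 from the
# per-`μ` arithmetic sums of Appendix B, kernel-checked as a DED edge

Topic `Literature/NumberTheory/LFunctions/Zhang2022` (Landau–Siegel audit tree; verdict-neutral).
Y. Zhang, *Discrete mean estimates and the Landau–Siegel zero*, arXiv:2211.02515v1 (2022)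
[Zhang2022LandauSiegel] — **an unrefereed manuscript under adjudication; nothing in this file
asserts any claim of the manuscript.** Cell siegel-zhang (D-0069), DISCHARGE row D16 (cone C37,
Lemma 15.1), DAG nodes `Z22:Lem15.1` / `Z22:Lem15.1.pf` [Z22 p.86, tex L4273 (statement); App. B
pp.106–108, tex L5248–5339 (proof)], in the `χ`-twisted reading `Skeleton.Lemma151Chi` chosen by the
cell (gap row G-L4t1-1, `SkeletonChiTwist`).

What the manuscript does and does not write. Lemma 15.1 states, for `n₁ ∈ 𝔫(𝔮)`, `n₁ < T`,
`Σ_{(n,𝔮)=1} b(n₁n)χ(n)ϱ*_j(n)/n = χ(n₁)τ₂(n₁)𝔢_j + O(α₁τ₂(n₁))` with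
`𝔢_j = (e_{1j} + ι₂e_{2j})(ῑ₃e_{3j} + ῑ₄e_{2j})`; its Appendix-B proof ONLY establishes (B.1), (B.2)
and the four one-variable evaluations `Σ_l ϰ_μ(l₁l)ϱ_j(l)/l = e_{μj} + O(α₁)` (`μ = 2, 3`, the full
`ϰ₁`-sum `= e′_{1j}`, and the tail (B.3) `= e″_{1j}`). The step from these to the lemma — `b` is the
Dirichlet convolution of `f = ϰ₁·[· < P^{1/2}] + ι₂ϰ₂` with `g = ῑ₃ϰ₃ + ῑ₄ϰ₂` ((12.2), (15.1)), and
for `n₁ ∈ 𝔫(𝔮)`, `(n,𝔮) = 1` the divisor pairs of `n₁n` split, so that the `n`-sum factorises over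
`n₁ = u₁v₁` into `[Σ_u f(u₁u)ϱ*_j(u)/u]·[Σ_v g(v₁v)ϱ*_j(v)/v]` up to the terms with `(u,v) > 1` — is
NOT in print. This file proves the assembly with that factorisation as ONE explicit hypothesis
(`hdec`, the cell's GAP row for the absent step, exact statement below) and everything else either
PROVED here or taken from the typed Appendix-B nodes:

* PROVED (companion `AppendixBLemma151Prelims`): `(n,𝔮)=1 ⇒ (n,D)=1`, `χ(n₁n)χ(n) = χ(n₁)` for
  `(n,D)=1`, `χ` real (the whole content of the twist), `norm_coprimeSum_sub_vkSum_le` — the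
  `ϱ*_j ↦ ϱ_j` swap for ANY weight `|ϰ| ≤ 1` from (B.1)–(B.2) (print: "for `μ = 2, 3`"; used silently
  for `ϰ₁`); `#{u₁v₁ = n₁} = τ₂(n₁)` is the tree's `GaussianHecke.card_divisorsAntidiagonal_eq`;
* HYPOTHESES = typed nodes of `TypedAppendixB` (L4-t10): `EqB_1`, `EqB_2` ((B.1), (B.2)), `StepB_mu2`,
  `StepB_mu3` (the `μ = 2, 3` evaluations), and the `μ = 1` truncated evaluation `hmu1`
  ("`e_{1j} = e′_{1j} − e″_{1j}`": `StepB_u012` minus `EqB_3`, stated on the truncated weight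
  `ϰ₁·[· < P^{1/2}]` of `Skeleton.bcoef` through t10's `vkSum`), plus `hdec`.

| theorem | node | printed / implicit sentence |
|---|---|---|
| `lemma151_assembly_rate` | `Z22:Lem15.1.pf` [Z22 pp.106–108] | Lemma 15.1 (χ-twisted; rate `r`: `α𝓛` for `Lemma151Chi`, `α₁ = α𝓛^{1.1}` for `Lemma151ChiR`) ⇐ (B.1), (B.2), the `μ`-evaluations, and the factorisation step; instantiated in `AppendixBLemma151Edges` |

WHAT THIS IS NOT: a proof of (B.1), (B.2), of the residue evaluations, of the factorisation step, or
of Lemma 15.1 itself; no claim about Theorems 1–2 or Landau–Siegel zeros. References: Y. Zhang,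
arXiv:2211.02515v1, §15 Lemma 15.1 (p. 86), (15.1)–(15.2), (12.2); App. B (B.1)–(B.3), pp. 106–108.
[cite: Zhang2022LandauSiegel, §15 Lemma 15.1, App. B]
-/

noncomputable section

open Complex Real ComplexConjugate

namespace Literature.NumberTheory.LFunctions.Zhang2022.Skeleton
open Typed.AppendixB (varrhoJ vkSum)

section Elementary

/-- `|(S₁ + cS₂) − (e₁ + ce₂)| ≤ δ₁ + |c|δ₂`. [folklore] -/
private theorem norm_add_mul_sub_add_mul_le {S₁ S₂ e₁ e₂ c : ℂ} {δ₁ δ₂ : ℝ} (h₁ : ‖S₁ - e₁‖ ≤ δ₁)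
    (h₂ : ‖S₂ - e₂‖ ≤ δ₂) : ‖(S₁ + c * S₂) - (e₁ + c * e₂)‖ ≤ δ₁ + ‖c‖ * δ₂ := by
  rw [show (S₁ + c * S₂) - (e₁ + c * e₂) = (S₁ - e₁) + c * (S₂ - e₂) by ring]
  refine (norm_add_le _ _).trans (add_le_add h₁ ?_)
  rw [norm_mul]; gcongr

/-- `|FG − A₁A₂| ≤ δ_F(|A₂| + δ_G) + |A₁|δ_G`. [folklore] -/
private theorem norm_mul_sub_mul_le' {F G A₁ A₂ : ℂ} {δF δG : ℝ} (hF : ‖F - A₁‖ ≤ δF)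
    (hG : ‖G - A₂‖ ≤ δG) : ‖F * G - A₁ * A₂‖ ≤ δF * (‖A₂‖ + δG) + ‖A₁‖ * δG := by
  have hG' : ‖G‖ ≤ ‖A₂‖ + δG :=
    calc ‖G‖ = ‖A₂ + (G - A₂)‖ := by ring_nf
      _ ≤ ‖A₂‖ + ‖G - A₂‖ := norm_add_le _ _
      _ ≤ ‖A₂‖ + δG := by gcongr
  have hδF : 0 ≤ δF := (norm_nonneg _).trans hF
  rw [show F * G - A₁ * A₂ = (F - A₁) * G + A₁ * (G - A₂) by ring]
  refine (norm_add_le _ _).trans ?_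
  rw [norm_mul, norm_mul]
  exact add_le_add (mul_le_mul hF hG' (norm_nonneg _) hδF)
    (mul_le_mul_of_nonneg_left hG (norm_nonneg _))

/-- Splitting a weighted sum with weight `w₁ + c·w₂`. [folklore] -/
private theorem sum_add_mul_weight (R : Finset ℕ) (w₁ w₂ h : ℕ → ℂ) (c : ℂ) :
    ∑ u ∈ R, (w₁ u + c * w₂ u) * h u / (u : ℂ) =
      (∑ u ∈ R, w₁ u * h u / (u : ℂ)) + c * ∑ u ∈ R, w₂ u * h u / (u : ℂ) := by
  rw [Finset.mul_sum, ← Finset.sum_add_distrib]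
  exact Finset.sum_congr rfl fun u _ => by ring

end Elementary

/-! ## The assembly: Lemma 15.1 (χ-twisted) from the Appendix-B sums -/

section Assembly

variable (c' : ℝ)

set_option maxHeartbeats 1600000 in
/-- **Lemma 15.1 (`χ`-twisted reading) assembled from Appendix B — generic in the error RATE `r`**
(`r D = α𝓛` gives `Skeleton.Lemma151Chi`, `r D = α₁ = α𝓛^{1.1}` gives the reading of record
`Skeleton.Lemma151ChiR`; see `AppendixBLemma151Edges`). Hypotheses: `r` eventually in `(𝓛⁻⁸, 1]`;
(B.1) `EqB_1`, (B.2) `EqB_2` (typed nodes); the `μ = 2, 3` evaluations of `Σ_l ϰ_μ(l₁l)ϱ_j(l)/l`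
(`= e_{2j}, e_{3j} + O(r)`, shapes of `StepB_mu2`/`StepB_mu3`); `hmu1` = the `μ = 1` evaluation on
the truncated weight `ϰ₁·[· < P^{1/2}]` of `b` ((15.1); "`e_{1j} = e′_{1j} − e″_{1j}`"); and `hdec` =
the factorisation of the `b`-sum over the divisor pairs of `n₁` (the step the printed proof omits;
GAP row G-d50-1 for `Z22:Lem15.1.pf`). Conclusion: the body of `Lemma151Chi`/`Lemma151ChiR` with rate `r`.
Proof: `χ(n₁n)χ(n) = χ(n₁)` on `(n,𝔮)=1` (so the twisted sum is `χ(n₁)·Σ b(n₁n)ϱ*_j(n)/n`); by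
`hdec` and, for each divisor pair `(u₁,v₁)` of `n₁` (`u₁, v₁ ∈ 𝔫(𝔮)`, `< T`), the swap
`ϱ*_j ↦ ϱ_j` (from (B.1)+(B.2), any `|ϰ| ≤ 1`) and the `μ`-evaluations:
`F(u₁) = e_{1j} + ι₂e_{2j} + O(r)`, `G(v₁) = ῑ₃e_{3j} + ῑ₄e_{2j} + O(r)`, whence
`Σ_{u₁v₁=n₁} F G = τ₂(n₁)𝔢_j + O(r·τ₂(n₁))` (`𝔢_j` = `Section18Defs.frake j`; `𝓛⁻⁸ ≤ r`).
[cite: Zhang2022LandauSiegel, §15 Lemma 15.1; App. B pp. 106–108] -/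
theorem lemma151_assembly_rate (r : ℕ → ℝ)
    (hr : ∃ D₁ : ℕ, ∀ D : ℕ, D₁ ≤ D → 0 < r D ∧ r D ≤ 1 ∧ (ell D ^ 8)⁻¹ ≤ r D)
    (hB1 : Typed.AppendixB.EqB_1 c') (hB2 : Typed.AppendixB.EqB_2 c')
    (hmu2 : ∃ C : ℝ, ForAllLarge fun D _ _ => ∀ j ∈ ({1, 2, 3} : Finset ℕ), ∀ l₁ : ℕ, 1 ≤ l₁ →
      l₁ ∈ nset (frakq D) → (l₁ : ℝ) < bigT D → ‖vkSum c' D (vk2 D) j l₁ - e2j j‖ ≤ C * r D)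
    (hmu3 : ∃ C : ℝ, ForAllLarge fun D _ _ => ∀ j ∈ ({1, 2, 3} : Finset ℕ), ∀ l₁ : ℕ, 1 ≤ l₁ →
      l₁ ∈ nset (frakq D) → (l₁ : ℝ) < bigT D → ‖vkSum c' D (vk3 D) j l₁ - e3j j‖ ≤ C * r D)
    (hmu1 : ∃ C : ℝ, ForAllLarge fun D _ _ => ∀ j ∈ ({1, 2, 3} : Finset ℕ), ∀ l₁ : ℕ, 1 ≤ l₁ →
      l₁ ∈ nset (frakq D) → (l₁ : ℝ) < bigT D →
        ‖vkSum c' D (fun m => if (m : ℝ) < bigP D ^ (1 / 2 : ℝ) then vk1 D m else 0) j l₁ -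
            e1j j‖ ≤ C * r D)
    (hdec : ∃ C : ℝ, ForAllLarge fun D _ χ => AssumptionA D χ → ∀ j ∈ ({1, 2, 3} : Finset ℕ),
      ∀ n₁ : ℕ, n₁ ∈ nset (frakq D) → (n₁ : ℝ) < bigT D →
        ‖(∑ n ∈ (Finset.Ico 1 ⌈bigP D⌉₊).filter (fun n => Nat.Coprime n (frakq D)),
            bcoef D (n₁ * n) * varrhoStar c' χ j n / (n : ℂ)) -
          ∑ p ∈ n₁.divisorsAntidiagonal,
            (∑ u ∈ (Finset.Ico 1 ⌈bigP D⌉₊).filter (fun n => Nat.Coprime n (frakq D)),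
              ((if ((p.1 * u : ℕ) : ℝ) < bigP D ^ (1 / 2 : ℝ) then vk1 D (p.1 * u) else 0) +
                iota2 * vk2 D (p.1 * u)) * varrhoStar c' χ j u / (u : ℂ)) *
            (∑ v ∈ (Finset.Ico 1 ⌈bigP D⌉₊).filter (fun n => Nat.Coprime n (frakq D)),
              (conj iota3 * vk3 D (p.2 * v) + conj iota4 * vk2 D (p.2 * v)) *
                varrhoStar c' χ j v / (v : ℂ))‖ ≤
          C * r D * n₁.divisors.card) :
    ∃ C : ℝ, ForAllLarge fun D _ χ => AssumptionA D χ → ∀ j ∈ ({1, 2, 3} : Finset ℕ), ∀ n₁ : ℕ,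
      n₁ ∈ nset (frakq D) → (n₁ : ℝ) < bigT D →
        ‖(∑ n ∈ (Finset.Ico 1 ⌈bigP D⌉₊).filter (fun n => Nat.Coprime n (frakq D)),
            χ ((n₁ * n : ℕ) : ZMod D) * bcoef D (n₁ * n) * χ (n : ZMod D) *
              varrhoStar c' χ j n / (n : ℂ)) -
          χ (n₁ : ZMod D) * (n₁.divisors.card : ℂ) * frake j‖ ≤ C * r D * n₁.divisors.card := by
  obtain ⟨C₁, h1⟩ := hB1
  obtain ⟨C₂, h2⟩ := hB2
  obtain ⟨C₃, h3⟩ := hmu2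
  obtain ⟨C₄, h4⟩ := hmu3
  obtain ⟨C₅, h5⟩ := hmu1
  obtain ⟨C₆, h6⟩ := hdec
  -- the constants: everything in units of `a = r D` (`𝓛⁻⁸ ≤ a ≤ 1`)
  set E : ℝ := max C₁ 0 + max C₂ 0 with hE
  set KF : ℝ := E + max C₅ 0 + ‖iota2‖ * (E + max C₃ 0) with hKF
  set KG : ℝ := ‖conj iota3‖ * (E + max C₄ 0) + ‖conj iota4‖ * (E + max C₃ 0) with hKG
  set N₁ : ℝ := ∑ j ∈ ({1, 2, 3} : Finset ℕ), ‖e1j j + iota2 * e2j j‖ with hN₁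
  set N₂ : ℝ := ∑ j ∈ ({1, 2, 3} : Finset ℕ), ‖conj iota3 * e3j j + conj iota4 * e2j j‖ with hN₂
  have hE0 : 0 ≤ E := by positivity
  have hKF0 : 0 ≤ KF := by positivity
  have hKG0 : 0 ≤ KG := by positivity
  have hN₁0 : 0 ≤ N₁ := Finset.sum_nonneg fun _ _ => norm_nonneg _
  have hN₂0 : 0 ≤ N₂ := Finset.sum_nonneg fun _ _ => norm_nonneg _
  obtain ⟨D₀, h⟩ := ((((h1.and h2).and h3).and h4).and h5).and h6
  obtain ⟨D₁, hr⟩ := hr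
  refine ⟨max C₆ 0 + (KF * (N₂ + KG) + N₁ * KG), max (max D₀ 8) D₁,
    fun D _ χ hD hq hp hA j hj n₁ hn₁ hT => ?_⟩
  obtain ⟨⟨⟨⟨⟨e1, e2⟩, e3⟩, e4⟩, e5⟩, e6⟩ :=
    h D χ (le_trans (le_trans (le_max_left _ _) (le_max_left _ _)) hD) hq hp
  obtain ⟨ha0, ha1, hℓ8⟩ := hr D (le_trans (le_max_right _ _) hD)
  have hD8 : 8 ≤ D := le_trans (le_trans (le_max_right _ _) (le_max_left _ _)) hD
  have hlog : 2 ≤ Real.log D := by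
    have h8 : (8 : ℝ) ≤ D := by exact_mod_cast hD8
    have he2 : Real.exp 2 ≤ 8 := by
      have h : Real.exp 2 = Real.exp 1 * Real.exp 1 := by rw [← Real.exp_add]; norm_num
      rw [h]; nlinarith [Real.exp_one_lt_d9, Real.exp_pos 1]
    calc (2 : ℝ) = Real.log (Real.exp 2) := (Real.log_exp 2).symm
      _ ≤ Real.log 8 := Real.log_le_log (Real.exp_pos _) he2
      _ ≤ Real.log D := Real.log_le_log (by norm_num) h8
  have hℓ2 : 2 ≤ ell D := hlog
  have hℓ0 : 0 < ell D := by linarith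
  set a : ℝ := r D with ha
  -- notation
  set R : Finset ℕ := (Finset.Ico 1 ⌈bigP D⌉₊).filter (fun n => Nat.Coprime n (frakq D)) with hR
  have htv1_le : ∀ m : ℕ,
      ‖(fun m : ℕ => if (m : ℝ) < bigP D ^ (1 / 2 : ℝ) then vk1 D m else 0) m‖ ≤ 1 := fun m => by
    dsimp only
    split_ifs
    · exact norm_vk1_le hlog m
    · rw [norm_zero]; exact zero_le_one
  have hvk2_le : ∀ m, ‖vk2 D m‖ ≤ 1 := norm_vk2_le hlog
  have hvk3_le : ∀ m, ‖vk3 D m‖ ≤ 1 := norm_vk3_le hlog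
  -- (B.1), (B.2) at this `j`, in the form `≤ E·a`
  have hB₁ : ∑ n ∈ R, ‖varrhoJ c' D j n - varrhoStar c' χ j n‖ / (n : ℝ) ≤ max C₁ 0 * a :=
    (e1 hA j hj).trans (by
      rw [div_eq_mul_inv]
      exact mul_le_mul (le_max_left _ _) hℓ8 (by positivity) (le_max_right _ _))
  have hB₂ : ∑ n ∈ (Finset.Ico 1 ⌈bigP D⌉₊).filter (fun n => ¬ Nat.Coprime n (frakq D)),
      ‖varrhoJ c' D j n‖ / (n : ℝ) ≤ max C₂ 0 * a :=
    (e2 j hj).trans (by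
      rw [div_eq_mul_inv]
      exact mul_le_mul (le_max_left _ _) hℓ8 (by positivity) (le_max_right _ _))
  -- the per-pair approximations
  set A₁ : ℂ := e1j j + iota2 * e2j j with hA₁
  set A₂ : ℂ := conj iota3 * e3j j + conj iota4 * e2j j with hA₂
  have hA₁N : ‖A₁‖ ≤ N₁ :=
    Finset.single_le_sum (f := fun j => ‖e1j j + iota2 * e2j j‖) (fun _ _ => norm_nonneg _) hj
  have hA₂N : ‖A₂‖ ≤ N₂ :=
    Finset.single_le_sum (f := fun j => ‖conj iota3 * e3j j + conj iota4 * e2j j‖)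
      (fun _ _ => norm_nonneg _) hj
  have hn₁0 : n₁ ≠ 0 := Nat.pos_iff_ne_zero.mp hn₁.1
  have pair : ∀ p ∈ n₁.divisorsAntidiagonal,
      ‖(∑ u ∈ R, ((if ((p.1 * u : ℕ) : ℝ) < bigP D ^ (1 / 2 : ℝ) then vk1 D (p.1 * u) else 0) +
          iota2 * vk2 D (p.1 * u)) * varrhoStar c' χ j u / (u : ℂ)) *
          (∑ v ∈ R, (conj iota3 * vk3 D (p.2 * v) + conj iota4 * vk2 D (p.2 * v)) *
            varrhoStar c' χ j v / (v : ℂ)) - A₁ * A₂‖ ≤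
        KF * a * (N₂ + KG * a) + N₁ * (KG * a) := by
    intro p hpm
    obtain ⟨hpn, -⟩ := Nat.mem_divisorsAntidiagonal.mp hpm
    have hd1 : p.1 ∣ n₁ := ⟨p.2, hpn.symm⟩
    have hd2 : p.2 ∣ n₁ := ⟨p.1, by rw [mul_comm]; exact hpn.symm⟩
    have hp1 : 1 ≤ p.1 := Nat.pos_of_dvd_of_pos hd1 hn₁.1
    have hp2 : 1 ≤ p.2 := Nat.pos_of_dvd_of_pos hd2 hn₁.1
    have hp1n : p.1 ∈ nset (frakq D) := mem_nset_of_dvd hn₁ hd1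
    have hp2n : p.2 ∈ nset (frakq D) := mem_nset_of_dvd hn₁ hd2
    have hp1T : (p.1 : ℝ) < bigT D :=
      lt_of_le_of_lt (by exact_mod_cast Nat.le_of_dvd hn₁.1 hd1) hT
    have hp2T : (p.2 : ℝ) < bigT D :=
      lt_of_le_of_lt (by exact_mod_cast Nat.le_of_dvd hn₁.1 hd2) hT
    -- F(u₁): split the weight, swap ϱ* ↦ ϱ, evaluate
    have hF : ‖(∑ u ∈ R, ((if ((p.1 * u : ℕ) : ℝ) < bigP D ^ (1 / 2 : ℝ) then vk1 D (p.1 * u)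
        else 0) + iota2 * vk2 D (p.1 * u)) * varrhoStar c' χ j u / (u : ℂ)) - A₁‖ ≤ KF * a := by
      rw [sum_add_mul_weight, hA₁]
      have s1 := norm_coprimeSum_sub_vkSum_le c' χ (j := j) (l₁ := p.1)
        (vk := fun m : ℕ => if (m : ℝ) < bigP D ^ (1 / 2 : ℝ) then vk1 D m else 0) htv1_le hB₁ hB₂
      have s2 := norm_coprimeSum_sub_vkSum_le c' χ (j := j) (l₁ := p.1)
        (vk := vk2 D) hvk2_le hB₁ hB₂
      have m1 := e5 j hj p.1 hp1 hp1n hp1T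
      have m2 := e3 j hj p.1 hp1 hp1n hp1T
      have t1 : ‖(∑ u ∈ R, (if ((p.1 * u : ℕ) : ℝ) < bigP D ^ (1 / 2 : ℝ) then vk1 D (p.1 * u)
          else 0) * varrhoStar c' χ j u / (u : ℂ)) - e1j j‖ ≤ E * a + max C₅ 0 * a := by
        refine (norm_sub_le_norm_sub_add_norm_sub _
          (vkSum c' D (fun m : ℕ => if (m : ℝ) < bigP D ^ (1 / 2 : ℝ) then vk1 D m else 0) j p.1)
          _).trans ?_
        refine add_le_add (s1.trans (by rw [hE]; ring_nf; rfl)) (m1.trans ?_)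
        exact mul_le_mul_of_nonneg_right (le_max_left _ _) ha0.le
      have t2 : ‖(∑ u ∈ R, vk2 D (p.1 * u) * varrhoStar c' χ j u / (u : ℂ)) - e2j j‖ ≤
          E * a + max C₃ 0 * a := by
        refine (norm_sub_le_norm_sub_add_norm_sub _ (vkSum c' D (vk2 D) j p.1) _).trans ?_
        refine add_le_add (s2.trans (by rw [hE]; ring_nf; rfl)) (m2.trans ?_)
        exact mul_le_mul_of_nonneg_right (le_max_left _ _) ha0.le
      refine (norm_add_mul_sub_add_mul_le t1 t2).trans (le_of_eq ?_)
      rw [hKF]; ring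
    -- G(v₁): likewise with `ῑ₃ϰ₃ + ῑ₄ϰ₂`
    have hG : ‖(∑ v ∈ R, (conj iota3 * vk3 D (p.2 * v) + conj iota4 * vk2 D (p.2 * v)) *
        varrhoStar c' χ j v / (v : ℂ)) - A₂‖ ≤ KG * a := by
      have hrw : ∑ v ∈ R, (conj iota3 * vk3 D (p.2 * v) + conj iota4 * vk2 D (p.2 * v)) *
          varrhoStar c' χ j v / (v : ℂ) =
          conj iota3 * (∑ v ∈ R, vk3 D (p.2 * v) * varrhoStar c' χ j v / (v : ℂ)) +
          conj iota4 * ∑ v ∈ R, vk2 D (p.2 * v) * varrhoStar c' χ j v / (v : ℂ) := by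
        rw [Finset.mul_sum, Finset.mul_sum, ← Finset.sum_add_distrib]
        exact Finset.sum_congr rfl fun v _ => by ring
      rw [hrw, hA₂]
      have s3 := norm_coprimeSum_sub_vkSum_le c' χ (j := j) (l₁ := p.2)
        (vk := vk3 D) hvk3_le hB₁ hB₂
      have s2 := norm_coprimeSum_sub_vkSum_le c' χ (j := j) (l₁ := p.2)
        (vk := vk2 D) hvk2_le hB₁ hB₂
      have m3 := e4 j hj p.2 hp2 hp2n hp2T
      have m2 := e3 j hj p.2 hp2 hp2n hp2T
      have t3 : ‖(∑ v ∈ R, vk3 D (p.2 * v) * varrhoStar c' χ j v / (v : ℂ)) - e3j j‖ ≤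
          E * a + max C₄ 0 * a := by
        refine (norm_sub_le_norm_sub_add_norm_sub _ (vkSum c' D (vk3 D) j p.2) _).trans ?_
        refine add_le_add (s3.trans (by rw [hE]; ring_nf; rfl)) (m3.trans ?_)
        exact mul_le_mul_of_nonneg_right (le_max_left _ _) ha0.le
      have t2 : ‖(∑ v ∈ R, vk2 D (p.2 * v) * varrhoStar c' χ j v / (v : ℂ)) - e2j j‖ ≤
          E * a + max C₃ 0 * a := by
        refine (norm_sub_le_norm_sub_add_norm_sub _ (vkSum c' D (vk2 D) j p.2) _).trans ?_
        refine add_le_add (s2.trans (by rw [hE]; ring_nf; rfl)) (m2.trans ?_)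
        exact mul_le_mul_of_nonneg_right (le_max_left _ _) ha0.le
      have : ‖(conj iota3 * (∑ v ∈ R, vk3 D (p.2 * v) * varrhoStar c' χ j v / (v : ℂ)) +
          conj iota4 * ∑ v ∈ R, vk2 D (p.2 * v) * varrhoStar c' χ j v / (v : ℂ)) -
          (conj iota3 * e3j j + conj iota4 * e2j j)‖ ≤
          ‖conj iota3‖ * (E * a + max C₄ 0 * a) + ‖conj iota4‖ * (E * a + max C₃ 0 * a) := by
        rw [show (conj iota3 * (∑ v ∈ R, vk3 D (p.2 * v) * varrhoStar c' χ j v / (v : ℂ)) +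
            conj iota4 * ∑ v ∈ R, vk2 D (p.2 * v) * varrhoStar c' χ j v / (v : ℂ)) -
            (conj iota3 * e3j j + conj iota4 * e2j j) =
            conj iota3 * ((∑ v ∈ R, vk3 D (p.2 * v) * varrhoStar c' χ j v / (v : ℂ)) - e3j j) +
            conj iota4 * ((∑ v ∈ R, vk2 D (p.2 * v) * varrhoStar c' χ j v / (v : ℂ)) - e2j j)
            by ring]
        refine (norm_add_le _ _).trans ?_
        rw [norm_mul, norm_mul]
        gcongr
      refine this.trans (le_of_eq ?_)
      rw [hKG]; ring
    refine (norm_mul_sub_mul_le' hF hG).trans ?_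
    have haKF : 0 ≤ KF * a := mul_nonneg hKF0 ha0.le
    have haKG : 0 ≤ KG * a := mul_nonneg hKG0 ha0.le
    exact add_le_add (mul_le_mul_of_nonneg_left (add_le_add hA₂N le_rfl) haKF)
      (mul_le_mul_of_nonneg_right hA₁N haKG)
  -- sum over the divisor pairs
  have hcard : (n₁.divisorsAntidiagonal.card : ℝ) = n₁.divisors.card := by
    rw [GaussianHecke.card_divisorsAntidiagonal_eq]
  have hfr : frake j = A₁ * A₂ := by rw [hA₁, hA₂, frake]
  have hconst : ∑ _p ∈ n₁.divisorsAntidiagonal, A₁ * A₂ = (n₁.divisors.card : ℂ) * frake j := by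
    rw [Finset.sum_const, nsmul_eq_mul, GaussianHecke.card_divisorsAntidiagonal_eq, hfr]
  have hKbound : KF * a * (N₂ + KG * a) + N₁ * (KG * a) ≤ (KF * (N₂ + KG) + N₁ * KG) * a := by
    have h1 : KG * a ≤ KG * 1 := mul_le_mul_of_nonneg_left ha1 hKG0
    have h2 : KF * a * (N₂ + KG * a) ≤ KF * a * (N₂ + KG) :=
      mul_le_mul_of_nonneg_left (by linarith) (mul_nonneg hKF0 ha0.le)
    nlinarith [mul_nonneg hKF0 ha0.le, mul_nonneg hKG0 ha0.le]
  have hpairs : ‖(∑ p ∈ n₁.divisorsAntidiagonal,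
      (∑ u ∈ R, ((if ((p.1 * u : ℕ) : ℝ) < bigP D ^ (1 / 2 : ℝ) then vk1 D (p.1 * u) else 0) +
          iota2 * vk2 D (p.1 * u)) * varrhoStar c' χ j u / (u : ℂ)) *
        (∑ v ∈ R, (conj iota3 * vk3 D (p.2 * v) + conj iota4 * vk2 D (p.2 * v)) *
          varrhoStar c' χ j v / (v : ℂ))) - (n₁.divisors.card : ℂ) * frake j‖ ≤
      (KF * (N₂ + KG) + N₁ * KG) * a * n₁.divisors.card := by
    rw [← hconst, ← Finset.sum_sub_distrib]
    refine (norm_sum_le _ _).trans ((Finset.sum_le_sum pair).trans ?_)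
    rw [Finset.sum_const, nsmul_eq_mul, hcard]
    have hτ0 : (0 : ℝ) ≤ n₁.divisors.card := Nat.cast_nonneg _
    calc (n₁.divisors.card : ℝ) * (KF * a * (N₂ + KG * a) + N₁ * (KG * a))
        ≤ (n₁.divisors.card : ℝ) * ((KF * (N₂ + KG) + N₁ * KG) * a) :=
          mul_le_mul_of_nonneg_left hKbound hτ0
      _ = (KF * (N₂ + KG) + N₁ * KG) * a * n₁.divisors.card := by ring
  -- the twist: the summand is `χ(n₁)·b(n₁n)ϱ*_j(n)/n`
  have hD2 : 2 ≤ D := le_trans (by norm_num) hD8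
  have htwist : (∑ n ∈ R, χ ((n₁ * n : ℕ) : ZMod D) * bcoef D (n₁ * n) * χ (n : ZMod D) *
      varrhoStar c' χ j n / (n : ℂ)) =
      χ (n₁ : ZMod D) * ∑ n ∈ R, bcoef D (n₁ * n) * varrhoStar c' χ j n / (n : ℂ) := by
    rw [Finset.mul_sum]
    refine Finset.sum_congr rfl fun n hn => ?_
    have hcop : Nat.Coprime n D :=
      coprime_of_coprime_frakq hD2 (Finset.mem_filter.mp hn).2
    rw [← chi_mul_mul_chi_eq hq n₁ hcop]
    ring
  have hdec' := e6 hA j hj n₁ hn₁ hT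
  have hχ1 : ‖χ (n₁ : ZMod D)‖ ≤ 1 := χ.norm_le_one _
  -- assembly
  have hrw : χ (n₁ : ZMod D) * (∑ n ∈ R, bcoef D (n₁ * n) * varrhoStar c' χ j n / (n : ℂ)) -
      χ (n₁ : ZMod D) * (n₁.divisors.card : ℂ) * frake j =
      χ (n₁ : ZMod D) * ((∑ n ∈ R, bcoef D (n₁ * n) * varrhoStar c' χ j n / (n : ℂ)) -
        (n₁.divisors.card : ℂ) * frake j) := by ring
  rw [htwist, hrw, norm_mul]
  have hτ0 : (0 : ℝ) ≤ n₁.divisors.card := Nat.cast_nonneg _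
  have hdec'' : ‖(∑ n ∈ R, bcoef D (n₁ * n) * varrhoStar c' χ j n / (n : ℂ)) -
      ∑ p ∈ n₁.divisorsAntidiagonal,
        (∑ u ∈ R, ((if ((p.1 * u : ℕ) : ℝ) < bigP D ^ (1 / 2 : ℝ) then vk1 D (p.1 * u) else 0) +
            iota2 * vk2 D (p.1 * u)) * varrhoStar c' χ j u / (u : ℂ)) *
          (∑ v ∈ R, (conj iota3 * vk3 D (p.2 * v) + conj iota4 * vk2 D (p.2 * v)) *
            varrhoStar c' χ j v / (v : ℂ))‖ ≤ max C₆ 0 * a * n₁.divisors.card :=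
    hdec'.trans (mul_le_mul_of_nonneg_right
      (mul_le_mul_of_nonneg_right (le_max_left _ _) ha0.le) hτ0)
  have hmain := (norm_sub_le_norm_sub_add_norm_sub _ _ _).trans (add_le_add hdec'' hpairs)
  calc ‖χ (n₁ : ZMod D)‖ *
        ‖(∑ n ∈ R, bcoef D (n₁ * n) * varrhoStar c' χ j n / (n : ℂ)) -
          (n₁.divisors.card : ℂ) * frake j‖
      ≤ 1 * ‖(∑ n ∈ R, bcoef D (n₁ * n) * varrhoStar c' χ j n / (n : ℂ)) -
          (n₁.divisors.card : ℂ) * frake j‖ :=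
        mul_le_mul_of_nonneg_right hχ1 (norm_nonneg _)
    _ ≤ max C₆ 0 * a * n₁.divisors.card + (KF * (N₂ + KG) + N₁ * KG) * a * n₁.divisors.card := by
        rw [one_mul]; exact hmain
    _ = (max C₆ 0 + (KF * (N₂ + KG) + N₁ * KG)) * r D * n₁.divisors.card := by
        rw [ha]; ring

end Assembly

end Literature.NumberTheory.LFunctions.Zhang2022.Skeleton
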